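import Literature.MathematicalPhysics.QuantumFieldTheory.OSReconstructionNoE1Proofs
import Literature.MathematicalPhysics.QuantumFieldTheory.OSJointSpectralMeasureUniqueness
import Literature.Analysis.FunctionSpaces.TranslationInvariantDistribution
import Summits.QuantumFields.YangMills.Theorems.PencilRigidityNPointIsotropyUniversalTwoPointMeasureSuperposition
import Summits.QuantumFields.YangMills.Theorems.PencilRigidityNPointIsotropyUniversalTwoPointMeasureSpectral
import Summits.QuantumFields.YangMills.Theorems.PencilRigidityNPointIsotropyUniversalTwoPointMeasureReference
import HarnessLib

/-!
# The universal two-point measure of an `e₀`-reflection-positive one-species Schwinger family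
(line `complex-rotation-bandlimit`, stub `universalTwoPointMeasure`)

Crux `stmt-QuantumFields-11686` (`Summit.QuantumFields.YangMills.Theses.PencilRigidity.NPointIsotropy`), roadmap
step R2 (groundwork for the degree-one doubled orbit kernel). For a one-species Schwinger family `S₁` on `ℝ⁴`
with `h : OSReconstructionNoE1 S₁.toLabelled` (reflection positivity along `e₀` and translation invariance on
`⁰𝒮`) there is ONE positive measure `μ₀` on momentum space, tempered (`∫ (1+‖p‖)^{-N} dμ₀ < ∞`) and carried
by `{p₀ ≥ 0}`, such that for every positive-time one-point test function `f` the joint spectral measure of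
the field vector `Ψ_f` is `|f̃|² μ₀`, `f̃(p) = ∫ f(x) e^{-x⁰p₀ + i x⃗·p⃗} dx` (Källén–Lehmann / OS form of the
two-point function; the hypothesis E0' is carried and not needed — temperedness of `𝔖₂` suffices).

Proof. (1) *Intertwining.* For positive-time one-point `g` and a Schwartz weight `w` vanishing on
`{a⁰ < 0}`, `Ψ_{w∗g} = ∫ w(a) e^{-a⁰H}U(a⃗)Ψ_g da` (`fieldVec_translationAverage_eq_integral`) has joint
spectral measure `|ŵ|² μ_g` (`isJointSpectralMeasure_integral_smul`); since `w ∗ g = g ∗ w`, uniqueness of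
joint spectral measures gives `|ŵ|² μ_g = |ĝ|² μ_w` for the reference functions `w = u_n`. (2) *Reference
family* (`exists_reference_family`): dilated bumps `u_n` with `|û_n| ≥ m (n+1)⁻⁴` on `{‖p‖ ≤ n+1}` and
`‖Ψ_{u_n}‖² ≲ (n+1)^{2L}` (E0 as a quadratic bound, `exists_seminorm_bound_sq`). (3) *The measure*:
`ν = Σ c_n μ_{u_n}` (`c_n = (n+1)^{-2L-2}`, finite), `w = Σ c_n |û_n|²` (strictly positive and finite on
`{p₀ ≥ 0}`, `w⁻¹ ≲ (1+‖p‖)^{2L+10}`), `μ₀ = w⁻¹ ν`; then `|f̃|² μ₀ = w⁻¹ Σ c_n |f̃|² μ_{u_n} =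
w⁻¹ Σ c_n |û_n|² μ_f = μ_f` and `∫ (1+‖p‖)^{-(2L+10)} dμ₀ ≲ ν(ℝ⁴) < ∞`.

References: K. Osterwalder, R. Schrader, Comm. Math. Phys. 31 (1973) §4.1; J. Glimm, A. Jaffe,
Quantum Physics (1987) §6.1–6.2; M. Reed, B. Simon, Methods of Modern Mathematical Physics II §IX.8.
[folklore]
-/

noncomputable section

namespace Summit.QuantumFields.YangMills.Theorems.NPointIsotropy.ComplexRotationBandlimit

open MeasureTheory Complex Set Filter Topology
open scoped InnerProductSpace ComplexConjugate SchwartzMap ENNReal NNReal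
open Literature.MathematicalPhysics.QuantumLattice Literature.MathematicalPhysics.AQFT
  Literature.MathematicalPhysics.QuantumFieldTheory
open Literature.Analysis.FunctionSpaces Literature.Analysis.FunctionSpaces.SchwartzAverage
open UniversalTwoPoint

namespace UniversalTwoPoint

/-- The Laplace–Fourier transform of a one-point test function, written over `ℝ⁴`. [folklore] -/
theorem transform_ofOne (f : 𝓢((Fin 1 → (EuclideanSpace ℝ (Fin 4))), ℂ)) (p : (EuclideanSpace ℝ (Fin 4))) :
    (∫ x : Fin 1 → (EuclideanSpace ℝ (Fin 4)), f x * cexp (-(((x 0) 0 * p 0 : ℝ) : ℂ) +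
        ((∑ j : Fin 3, (x 0) j.succ * p j.succ : ℝ) : ℂ) * I)) =
      ∫ a : (EuclideanSpace ℝ (Fin 4)), ((SchwartzMap.compCLMOfContinuousLinearEquiv ℂ (ContinuousLinearEquiv.symm (ContinuousLinearEquiv.funUnique (Fin 1) ℝ (EuclideanSpace ℝ (Fin 4))))) f) a * cexp (-((a 0 * p 0 : ℝ) : ℂ) +
        ((∑ j : Fin 3, a j.succ * p j.succ : ℝ) : ℂ) * I) := by
  rw [← (volume_preserving_funUnique (Fin 1) (EuclideanSpace ℝ (Fin 4))).integral_comp']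
  refine integral_congr_ae (Eventually.of_forall fun x => ?_)
  have hx : (fun _ : Fin 1 => x 0) = x := funext fun i => by rw [Subsingleton.elim i 0]
  simp only [ofOne_apply, MeasurableEquiv.funUnique_apply]
  change f x * _ = f (fun _ => x default) * _
  rw [Fin.default_eq_zero, hx]

/-- **Intertwining relation.** For positive-time one-point `f`, `g = toOne u` and a reference weight `u`
supported in `{a⁰ ≥ δ}` (`δ > 0`): `|ôfOne f|² μ_g = |û|² μ_f` for the canonical joint spectral measures. [folklore] -/
theorem withDensity_transform_eq {S₁ : SchwingerFamily (EuclideanSpace ℝ (Fin 4))} (h : OSReconstructionNoE1 S₁.toLabelled)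
    (f : 𝓢((Fin 1 → (EuclideanSpace ℝ (Fin 4))), ℂ)) (hf : IsTimeOrdered f) (u : 𝓢((EuclideanSpace ℝ (Fin 4)), ℂ)) {δ : ℝ} (hδ : 0 < δ)
    (hu : ∀ a, u a ≠ 0 → δ ≤ a 0) (hu' : IsTimeOrdered ((SchwartzMap.compCLMOfContinuousLinearEquiv ℂ (ContinuousLinearEquiv.funUnique (Fin 1) ℝ (EuclideanSpace ℝ (Fin 4)))) u)) :
    (h.jointSpectralMeasure (h.fieldVec 1 (fun _ => ()) ((SchwartzMap.compCLMOfContinuousLinearEquiv ℂ (ContinuousLinearEquiv.funUnique (Fin 1) ℝ (EuclideanSpace ℝ (Fin 4)))) u) hu')).withDensity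
        (fun p => ENNReal.ofReal (‖∫ a, ((SchwartzMap.compCLMOfContinuousLinearEquiv ℂ (ContinuousLinearEquiv.symm (ContinuousLinearEquiv.funUnique (Fin 1) ℝ (EuclideanSpace ℝ (Fin 4))))) f) a * cexp (-((a 0 * p 0 : ℝ) : ℂ) +
          ((∑ j : Fin 3, a j.succ * p j.succ : ℝ) : ℂ) * I)‖ ^ 2)) =
      (h.jointSpectralMeasure (h.fieldVec 1 (fun _ => ()) f hf)).withDensity
        (fun p => ENNReal.ofReal (‖∫ a, u a * cexp (-((a 0 * p 0 : ℝ) : ℂ) +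
          ((∑ j : Fin 3, a j.succ * p j.succ : ℝ) : ℂ) * I)‖ ^ 2)) := by
  have hJ : ∀ φ : h.Hilbert, h.IsJointSpectralMeasure φ (h.jointSpectralMeasure φ) := fun φ =>
    h.isJointSpectralMeasure_jointSpectralMeasure
      (OSReconstructionNoE1.exists_isJointSpectralMeasure_holds h φ)
  have hu_w : ∀ a, u a ≠ 0 → 0 ≤ a 0 := fun a ha => hδ.le.trans (hu a ha)
  have hv_to : IsTimeOrdered ((SchwartzMap.compCLMOfContinuousLinearEquiv ℂ (ContinuousLinearEquiv.funUnique (Fin 1) ℝ (EuclideanSpace ℝ (Fin 4)))) ((SchwartzMap.compCLMOfContinuousLinearEquiv ℂ (ContinuousLinearEquiv.symm (ContinuousLinearEquiv.funUnique (Fin 1) ℝ (EuclideanSpace ℝ (Fin 4))))) f)) := by rw [toOne_ofOne]; exact hf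
  have hv_w : ∀ a, ((SchwartzMap.compCLMOfContinuousLinearEquiv ℂ (ContinuousLinearEquiv.symm (ContinuousLinearEquiv.funUnique (Fin 1) ℝ (EuclideanSpace ℝ (Fin 4))))) f) a ≠ 0 → 0 ≤ a 0 := fun a ha => (pos_of_ofOne_ne_zero hf ha).le
  -- the averaged function is supported in `{x⁰ ≥ δ}`
  have hK_to : IsTimeOrdered ((SchwartzMap.compCLMOfContinuousLinearEquiv ℂ (ContinuousLinearEquiv.funUnique (Fin 1) ℝ (EuclideanSpace ℝ (Fin 4)))) (translationAverage (ContinuousLinearMap.id ℝ (EuclideanSpace ℝ (Fin 4))) ((SchwartzMap.compCLMOfContinuousLinearEquiv ℂ (ContinuousLinearEquiv.symm (ContinuousLinearEquiv.funUnique (Fin 1) ℝ (EuclideanSpace ℝ (Fin 4))))) f) u)) := by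
    refine isTimeOrdered_of_forall_le hδ fun x hx => ?_
    rw [toOne_apply, translationAverage_apply] at hx
    by_contra hlt
    rw [not_le] at hlt
    apply hx
    have hzero : (fun a : (EuclideanSpace ℝ (Fin 4)) => ((SchwartzMap.compCLMOfContinuousLinearEquiv ℂ (ContinuousLinearEquiv.symm (ContinuousLinearEquiv.funUnique (Fin 1) ℝ (EuclideanSpace ℝ (Fin 4))))) f) a * u (x 0 - (ContinuousLinearMap.id ℝ (EuclideanSpace ℝ (Fin 4))) a)) = fun _ => 0 := by
      funext a
      by_cases hva : ((SchwartzMap.compCLMOfContinuousLinearEquiv ℂ (ContinuousLinearEquiv.symm (ContinuousLinearEquiv.funUnique (Fin 1) ℝ (EuclideanSpace ℝ (Fin 4))))) f) a = 0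
      · rw [hva, zero_mul]
      · have ha : 0 < a 0 := pos_of_ofOne_ne_zero hf hva
        have hua : u (x 0 - a) = 0 := by
          by_contra hne
          have h1 := hu _ hne
          simp only [PiLp.sub_apply] at h1
          linarith
        rw [ContinuousLinearMap.id_apply, hua, mul_zero]
    rw [hzero, integral_zero]
  have hK_to' : IsTimeOrdered ((SchwartzMap.compCLMOfContinuousLinearEquiv ℂ (ContinuousLinearEquiv.funUnique (Fin 1) ℝ (EuclideanSpace ℝ (Fin 4)))) (translationAverage (ContinuousLinearMap.id ℝ (EuclideanSpace ℝ (Fin 4))) u ((SchwartzMap.compCLMOfContinuousLinearEquiv ℂ (ContinuousLinearEquiv.symm (ContinuousLinearEquiv.funUnique (Fin 1) ℝ (EuclideanSpace ℝ (Fin 4))))) f))) := by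
    rw [← translationAverage_id_comm]; exact hK_to
  -- `Φ = Ψ_{(ofOne f) ∗ u}` as a superposition of translates of `Ψ_{toOne u}` …
  have h1 := fieldVec_translationAverage_eq_integral h hu' hv_w hK_to
  have hS1 := isJointSpectralMeasure_integral_smul h _ (hJ (h.fieldVec 1 (fun _ => ()) ((SchwartzMap.compCLMOfContinuousLinearEquiv ℂ (ContinuousLinearEquiv.funUnique (Fin 1) ℝ (EuclideanSpace ℝ (Fin 4)))) u) hu'))
    ((SchwartzMap.compCLMOfContinuousLinearEquiv ℂ (ContinuousLinearEquiv.symm (ContinuousLinearEquiv.funUnique (Fin 1) ℝ (EuclideanSpace ℝ (Fin 4))))) f) hv_w (integrable_smul_transfer_translate h ((SchwartzMap.compCLMOfContinuousLinearEquiv ℂ (ContinuousLinearEquiv.symm (ContinuousLinearEquiv.funUnique (Fin 1) ℝ (EuclideanSpace ℝ (Fin 4))))) f) _)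
  rw [← h1] at hS1
  -- … and `Φ = Ψ_{u ∗ ofOne f}` as a superposition of translates of `Ψ_f`
  have h2 := fieldVec_translationAverage_eq_integral h hv_to hu_w hK_to'
  rw [fieldVec_congr' h (toOne_ofOne f) hv_to hf] at h2
  have hS2 := isJointSpectralMeasure_integral_smul h _ (hJ (h.fieldVec 1 (fun _ => ()) f hf))
    u hu_w (integrable_smul_transfer_translate h u _)
  rw [← h2] at hS2
  have heq : h.fieldVec 1 (fun _ => ())
      ((SchwartzMap.compCLMOfContinuousLinearEquiv ℂ (ContinuousLinearEquiv.funUnique (Fin 1) ℝ (EuclideanSpace ℝ (Fin 4)))) (translationAverage (ContinuousLinearMap.id ℝ (EuclideanSpace ℝ (Fin 4))) ((SchwartzMap.compCLMOfContinuousLinearEquiv ℂ (ContinuousLinearEquiv.symm (ContinuousLinearEquiv.funUnique (Fin 1) ℝ (EuclideanSpace ℝ (Fin 4))))) f) u)) hK_to =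
      h.fieldVec 1 (fun _ => ())
        ((SchwartzMap.compCLMOfContinuousLinearEquiv ℂ (ContinuousLinearEquiv.funUnique (Fin 1) ℝ (EuclideanSpace ℝ (Fin 4)))) (translationAverage (ContinuousLinearMap.id ℝ (EuclideanSpace ℝ (Fin 4))) u ((SchwartzMap.compCLMOfContinuousLinearEquiv ℂ (ContinuousLinearEquiv.symm (ContinuousLinearEquiv.funUnique (Fin 1) ℝ (EuclideanSpace ℝ (Fin 4))))) f))) hK_to' :=
    fieldVec_congr' h (by rw [translationAverage_id_comm]) _ _
  rw [heq] at hS1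
  exact hS1.unique hS2

end UniversalTwoPoint

/-- **The universal two-point measure.** For a one-species Schwinger family `S₁` on `ℝ⁴` with reflection
positivity along `e₀` and translation invariance on `⁰𝒮` (`h : OSReconstructionNoE1 S₁.toLabelled`; E0' is
carried and unused) there is one tempered positive measure `μ₀` on momentum space carried by `{p₀ ≥ 0}` with
`μ_{Ψ_f} = |f̃|² μ₀` for every positive-time one-point `f`, `f̃(p) = ∫ f(x) e^{-x⁰p₀ + i x⃗·p⃗} dx`. [folklore] -/
theorem universalTwoPointMeasure : ∀ (S₁ : Literature.MathematicalPhysics.QuantumLattice.SchwingerFamily (EuclideanSpace ℝ (Fin 4))) (h : Literature.MathematicalPhysics.QuantumFieldTheory.OSReconstructionNoE1 S₁.toLabelled), S₁.toLabelled.HasLinearGrowth → ∃ (μ₀ : MeasureTheory.Measure (EuclideanSpace ℝ (Fin 4))) (N : ℕ), MeasureTheory.Integrable (fun p : EuclideanSpace ℝ (Fin 4) => (1 + ‖p‖) ^ (-(N : ℝ))) μ₀ ∧ μ₀ {p : EuclideanSpace ℝ (Fin 4) | p 0 < 0} = 0 ∧ ∀ (f : SchwartzMap (Fin 1 → EuclideanSpace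 ℝ (Fin 4)) ℂ) (hf : Literature.MathematicalPhysics.QuantumLattice.IsTimeOrdered f), h.IsJointSpectralMeasure (h.fieldVec 1 (fun _ => ()) f hf) (μ₀.withDensity fun p : EuclideanSpace ℝ (Fin 4) => ENNReal.ofReal (‖∫ x : Fin 1 → EuclideanSpace ℝ (Fin 4), f x * Complex.exp (-(((x 0) 0 * p 0 : ℝ) : ℂ) + ((∑ j : Fin 3, (x 0) j.succ * p j.succ : ℝ) : ℂ) * Complex.I)‖ ^ 2)) := by
  intro S₁ h _
  classical
  have hJ : ∀ φ : h.Hilbert, h.IsJointSpectralMeasure φ (h.jointSpectralMeasure φ) := fun φ =>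
    h.isJointSpectralMeasure_jointSpectralMeasure
      (OSReconstructionNoE1.exists_isJointSpectralMeasure_holds h φ)
  -- Step 1: the reference family and its field vectors
  obtain ⟨u, m, hm, hsupp, hlow, ⟨I₀, hI₀⟩, hgrow⟩ := exists_reference_family
  have hRpos : ∀ n : ℕ, (0 : ℝ) < (n : ℝ) + 1 := fun n => by positivity
  have hu_to : ∀ n, IsTimeOrdered ((SchwartzMap.compCLMOfContinuousLinearEquiv ℂ (ContinuousLinearEquiv.funUnique (Fin 1) ℝ (EuclideanSpace ℝ (Fin 4)))) (u n)) := fun n =>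
    isTimeOrdered_of_forall_le (inv_pos.2 (hRpos n)) fun x hx => by
      rw [toOne_apply] at hx; exact hsupp n _ hx
  have hu_w : ∀ n a, u n a ≠ 0 → 0 ≤ a 0 := fun n a ha => (inv_pos.2 (hRpos n)).le.trans (hsupp n a ha)
  set Ψ : ℕ → h.Hilbert := fun n => h.fieldVec 1 (fun _ => ()) ((SchwartzMap.compCLMOfContinuousLinearEquiv ℂ (ContinuousLinearEquiv.funUnique (Fin 1) ℝ (EuclideanSpace ℝ (Fin 4)))) (u n)) (hu_to n) with hΨ
  set ν : ℕ → Measure (EuclideanSpace ℝ (Fin 4)) := fun n => h.jointSpectralMeasure (Ψ n) with hν_def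
  have hν : ∀ n, h.IsJointSpectralMeasure (Ψ n) (ν n) := fun n => hJ _
  -- Step 2: polynomial growth of `‖Ψ n‖²`
  obtain ⟨s, C₁, hC₁, hbound⟩ := exists_seminorm_bound_sq h
  obtain ⟨C₂, L, hC₂⟩ := hgrow s
  have hnormsq : ∀ n, ‖Ψ n‖ ^ 2 ≤ C₁ * C₂ ^ 2 * (((n : ℝ) + 1) ^ L) ^ 2 := by
    intro n
    have h1 := hbound (u n) (hu_to n)
    have h2 : ((s.sup (schwartzSeminormFamily ℂ (EuclideanSpace ℝ (Fin 4)) ℂ)) (u n)) ^ 2 ≤ (C₂ * ((n : ℝ) + 1) ^ L) ^ 2 :=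
      pow_le_pow_left₀ (apply_nonneg _ _) (hC₂ n) 2
    calc ‖Ψ n‖ ^ 2 ≤ C₁ * ((s.sup (schwartzSeminormFamily ℂ (EuclideanSpace ℝ (Fin 4)) ℂ)) (u n)) ^ 2 := h1
      _ ≤ C₁ * (C₂ * ((n : ℝ) + 1) ^ L) ^ 2 := mul_le_mul_of_nonneg_left h2 hC₁
      _ = C₁ * C₂ ^ 2 * (((n : ℝ) + 1) ^ L) ^ 2 := by ring
  -- Step 3: the weights, the normalising density and the measure
  set c : ℕ → ℝ := fun n => ((((n : ℝ) + 1) ^ (2 * L + 2))⁻¹ : ℝ) with hc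
  have hc0 : ∀ n, 0 ≤ c n := fun n => by rw [hc]; positivity
  have hcsum : Summable fun n : ℕ => (((n : ℝ) + 1) ^ 2)⁻¹ := by
    have := (summable_nat_add_iff (f := fun n : ℕ => ((n : ℝ) ^ 2)⁻¹) 1).2
      (Real.summable_nat_pow_inv.2 one_lt_two)
    simpa [Nat.cast_add, Nat.cast_one] using this
  have hc_le : ∀ n, c n ≤ (((n : ℝ) + 1) ^ 2)⁻¹ := by
    intro n
    rw [hc]
    refine inv_anti₀ (by positivity) ?_
    exact pow_le_pow_right₀ (by linarith [(n.cast_nonneg : (0 : ℝ) ≤ n)]) (by omega)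
  have hcsum' : Summable c := Summable.of_nonneg_of_le hc0 hc_le hcsum
  set g : ℕ → (EuclideanSpace ℝ (Fin 4)) → ℝ≥0∞ := fun n p => ENNReal.ofReal (c n *
    ‖∫ a, u n a * cexp (-((a 0 * p 0 : ℝ) : ℂ) + ((∑ j : Fin 3, a j.succ * p j.succ : ℝ) : ℂ) * I)‖ ^ 2)
    with hg
  have hg_meas : ∀ n, Measurable (g n) := fun n =>
    (((measurable_transform (u n)).norm.pow_const 2).const_mul (c n)).ennreal_ofReal
  set wgt : (EuclideanSpace ℝ (Fin 4)) → ℝ≥0∞ := ∑' n, g n with hwgt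
  have hwgt_apply : ∀ p, wgt p = ∑' n, g n p := fun p => by
    rw [hwgt]; exact tsum_apply (Pi.summable.2 fun _ => ENNReal.summable)
  have hwgt_meas : Measurable wgt := by
    have : wgt = fun p => ∑' n, g n p := funext hwgt_apply
    rw [this]; exact Measurable.tsum hg_meas
  have hwinv_meas : Measurable fun p => (wgt p)⁻¹ := hwgt_meas.inv
  -- upper bound: `wgt ≤ Σ c_n I₀²` on `{p₀ ≥ 0}`
  have hwgt_top : ∀ p : (EuclideanSpace ℝ (Fin 4)), 0 ≤ p 0 → wgt p ≠ ⊤ := by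
    intro p hp
    rw [hwgt_apply]
    refine ne_top_of_le_ne_top (ENNReal.ofReal_ne_top (r := ∑' n, c n * I₀ ^ 2)) ?_
    rw [ENNReal.ofReal_tsum_of_nonneg (fun n => by positivity) (hcsum'.mul_right _)]
    refine ENNReal.tsum_le_tsum fun n => ENNReal.ofReal_le_ofReal ?_
    refine mul_le_mul_of_nonneg_left (pow_le_pow_left₀ (norm_nonneg _)
      ((norm_transform_le (u n) (hu_w n) hp).trans (hI₀ n)) 2) (hc0 n)
  -- lower bound: `wgt p ≥ m² (1+‖p‖)^{-(2L+10)}` on `{p₀ ≥ 0}`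
  have hwgt_low : ∀ p : (EuclideanSpace ℝ (Fin 4)), 0 ≤ p 0 →
      ENNReal.ofReal (m ^ 2 * ((1 + ‖p‖) ^ (2 * L + 10))⁻¹) ≤ wgt p := by
    intro p hp
    set n₀ : ℕ := ⌊‖p‖⌋₊ with hn₀
    have hn₀1 : ‖p‖ ≤ (n₀ : ℝ) + 1 := (Nat.lt_floor_add_one ‖p‖).le
    have hn₀2 : (n₀ : ℝ) + 1 ≤ 1 + ‖p‖ := by
      have := Nat.floor_le (norm_nonneg p); linarith
    have hlow' := hlow n₀ p hp hn₀1
    rw [hwgt_apply]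
    refine le_trans ?_ (ENNReal.le_tsum n₀)
    refine ENNReal.ofReal_le_ofReal ?_
    -- `m ≤ (n₀+1)⁴ |û_{n₀}(p)|` gives `c n₀ |û|² ≥ m² (n₀+1)^{-(2L+10)} ≥ m² (1+‖p‖)^{-(2L+10)}`
    set T : ℝ := ‖∫ a, u n₀ a * cexp (-((a 0 * p 0 : ℝ) : ℂ) +
      ((∑ j : Fin 3, a j.succ * p j.succ : ℝ) : ℂ) * I)‖ with hT
    have hT0 : 0 ≤ T := norm_nonneg _
    have hR : (0 : ℝ) < (n₀ : ℝ) + 1 := hRpos n₀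
    have h1 : m ^ 2 ≤ ((n₀ : ℝ) + 1) ^ 8 * T ^ 2 := by
      have := pow_le_pow_left₀ hm.le hlow' 2
      calc m ^ 2 ≤ (((n₀ : ℝ) + 1) ^ 4 * T) ^ 2 := this
        _ = ((n₀ : ℝ) + 1) ^ 8 * T ^ 2 := by ring
    have h2 : m ^ 2 * ((1 + ‖p‖) ^ (2 * L + 10))⁻¹ ≤ m ^ 2 * (((n₀ : ℝ) + 1) ^ (2 * L + 10))⁻¹ := by
      refine mul_le_mul_of_nonneg_left (inv_anti₀ (by positivity) ?_) (sq_nonneg _)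
      exact pow_le_pow_left₀ hR.le hn₀2 _
    refine h2.trans ?_
    rw [hc]
    simp only
    rw [show (2 * L + 10 : ℕ) = (2 * L + 2) + 8 by omega, pow_add, mul_inv]
    have hB : (0 : ℝ) < ((n₀ : ℝ) + 1) ^ 8 := by positivity
    calc m ^ 2 * ((((n₀ : ℝ) + 1) ^ (2 * L + 2))⁻¹ * (((n₀ : ℝ) + 1) ^ 8)⁻¹)
        = (((n₀ : ℝ) + 1) ^ (2 * L + 2))⁻¹ * (m ^ 2 * (((n₀ : ℝ) + 1) ^ 8)⁻¹) := by ring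
      _ ≤ (((n₀ : ℝ) + 1) ^ (2 * L + 2))⁻¹ * T ^ 2 := by
        refine mul_le_mul_of_nonneg_left ?_ (by positivity)
        rw [mul_inv_le_iff₀ hB]
        linarith [h1]
  have hwgt_ne_zero : ∀ p : (EuclideanSpace ℝ (Fin 4)), 0 ≤ p 0 → wgt p ≠ 0 := by
    intro p hp
    refine (lt_of_lt_of_le ?_ (hwgt_low p hp)).ne'
    exact ENNReal.ofReal_pos.2 (by positivity)
  have hwgt_inv_le : ∀ p : (EuclideanSpace ℝ (Fin 4)), 0 ≤ p 0 →
      ((wgt p)⁻¹).toReal ≤ (m ^ 2)⁻¹ * (1 + ‖p‖) ^ (2 * L + 10) := by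
    intro p hp
    have hpos : 0 < m ^ 2 * ((1 + ‖p‖) ^ (2 * L + 10))⁻¹ := by positivity
    have h1 : (wgt p)⁻¹ ≤ (ENNReal.ofReal (m ^ 2 * ((1 + ‖p‖) ^ (2 * L + 10))⁻¹))⁻¹ :=
      ENNReal.inv_le_inv.2 (hwgt_low p hp)
    rw [← ENNReal.ofReal_inv_of_pos hpos] at h1
    have h2 := ENNReal.toReal_mono ENNReal.ofReal_ne_top h1
    rw [ENNReal.toReal_ofReal (by positivity)] at h2
    refine h2.trans (le_of_eq ?_)
    rw [mul_inv, inv_inv]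
  -- the finite measure `ν = Σ c_n μ_{u_n}` and `μ₀ = wgt⁻¹ ν`
  set νs : Measure (EuclideanSpace ℝ (Fin 4)) := Measure.sum fun n => ENNReal.ofReal (c n) • ν n with hνs
  have hνs_fin : IsFiniteMeasure νs := by
    refine ⟨?_⟩
    rw [hνs, Measure.sum_apply _ MeasurableSet.univ]
    simp only [Measure.smul_apply, smul_eq_mul]
    have hle : ∀ n, ENNReal.ofReal (c n) * ν n univ ≤
        ENNReal.ofReal (C₁ * C₂ ^ 2 * (((n : ℝ) + 1) ^ 2)⁻¹) := by
      intro n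
      rw [(hν n).measure_univ, ← ENNReal.ofReal_mul (hc0 n)]
      refine ENNReal.ofReal_le_ofReal ?_
      calc c n * ‖Ψ n‖ ^ 2 ≤ c n * (C₁ * C₂ ^ 2 * (((n : ℝ) + 1) ^ L) ^ 2) :=
            mul_le_mul_of_nonneg_left (hnormsq n) (hc0 n)
        _ = C₁ * C₂ ^ 2 * (((n : ℝ) + 1) ^ 2)⁻¹ := by
            rw [hc]
            simp only
            have hR : (0 : ℝ) < (n : ℝ) + 1 := hRpos n
            field_simp
            ring
    refine lt_of_le_of_lt (ENNReal.tsum_le_tsum hle) ?_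
    rw [← ENNReal.ofReal_tsum_of_nonneg (fun n => by positivity) (hcsum.mul_left _)]
    exact ENNReal.ofReal_lt_top
  have hνs_neg : νs {p : (EuclideanSpace ℝ (Fin 4)) | p 0 < 0} = 0 := by
    rw [hνs, Measure.sum_apply_eq_zero]
    intro n
    rw [Measure.smul_apply, (hν n).energy_nonneg, smul_zero]
  have hνs_ae : ∀ᵐ p ∂νs, 0 ≤ p 0 := LaplaceFourierHalfSpace.ae_nonneg_apply_zero νs hνs_neg
  set μ₀ : Measure (EuclideanSpace ℝ (Fin 4)) := νs.withDensity fun p => (wgt p)⁻¹ with hμ₀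
  refine ⟨μ₀, 2 * L + 10, ?_, ?_, ?_⟩
  · -- temperedness
    have hlt : ∀ᵐ p ∂νs, (wgt p)⁻¹ < ⊤ := by
      filter_upwards [hνs_ae] with p hp
      exact ENNReal.inv_lt_top.2 (pos_iff_ne_zero.2 (hwgt_ne_zero p hp))
    rw [hμ₀, integrable_withDensity_iff hwinv_meas hlt]
    haveI := hνs_fin
    refine (integrable_const ((m ^ 2)⁻¹)).mono' ?_ ?_
    · refine (Measurable.mul ?_ hwinv_meas.ennreal_toReal).aestronglyMeasurable
      exact (measurable_const.add measurable_norm).pow_const _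
    · filter_upwards [hνs_ae] with p hp
      have h0 : 0 < 1 + ‖p‖ := by positivity
      rw [Real.norm_of_nonneg (mul_nonneg (Real.rpow_nonneg h0.le _) ENNReal.toReal_nonneg),
        Real.rpow_neg h0.le, Real.rpow_natCast]
      calc ((1 + ‖p‖) ^ (2 * L + 10))⁻¹ * ((wgt p)⁻¹).toReal
          ≤ ((1 + ‖p‖) ^ (2 * L + 10))⁻¹ * ((m ^ 2)⁻¹ * (1 + ‖p‖) ^ (2 * L + 10)) :=
            mul_le_mul_of_nonneg_left (hwgt_inv_le p hp) (by positivity)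
        _ = (m ^ 2)⁻¹ := by field_simp
  · -- carried by `{p₀ ≥ 0}`
    rw [hμ₀]
    exact withDensity_absolutelyContinuous νs _ hνs_neg
  · -- the representation `μ_{Ψ_f} = |f̃|² μ₀`
    intro f hf
    have hρ : (fun p : (EuclideanSpace ℝ (Fin 4)) => ENNReal.ofReal (‖∫ x : Fin 1 → (EuclideanSpace ℝ (Fin 4)), f x * cexp (-(((x 0) 0 * p 0 : ℝ) : ℂ) +
        ((∑ j : Fin 3, (x 0) j.succ * p j.succ : ℝ) : ℂ) * I)‖ ^ 2)) =
        fun p => ENNReal.ofReal (‖∫ a : (EuclideanSpace ℝ (Fin 4)), ((SchwartzMap.compCLMOfContinuousLinearEquiv ℂ (ContinuousLinearEquiv.symm (ContinuousLinearEquiv.funUnique (Fin 1) ℝ (EuclideanSpace ℝ (Fin 4))))) f) a * cexp (-((a 0 * p 0 : ℝ) : ℂ) +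
          ((∑ j : Fin 3, a j.succ * p j.succ : ℝ) : ℂ) * I)‖ ^ 2) := by
      funext p; rw [transform_ofOne]
    rw [hρ]
    set μf : Measure (EuclideanSpace ℝ (Fin 4)) := h.jointSpectralMeasure (h.fieldVec 1 (fun _ => ()) f hf) with hμf
    have hμfJ : h.IsJointSpectralMeasure (h.fieldVec 1 (fun _ => ()) f hf) μf := hJ _
    haveI := hμfJ.isFiniteMeasure
    have hρmeas : Measurable fun p : (EuclideanSpace ℝ (Fin 4)) => ENNReal.ofReal (‖∫ a : (EuclideanSpace ℝ (Fin 4)), ((SchwartzMap.compCLMOfContinuousLinearEquiv ℂ (ContinuousLinearEquiv.symm (ContinuousLinearEquiv.funUnique (Fin 1) ℝ (EuclideanSpace ℝ (Fin 4))))) f) a *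
        cexp (-((a 0 * p 0 : ℝ) : ℂ) + ((∑ j : Fin 3, a j.succ * p j.succ : ℝ) : ℂ) * I)‖ ^ 2) :=
      measurable_ofReal_norm_transform_sq ((SchwartzMap.compCLMOfContinuousLinearEquiv ℂ (ContinuousLinearEquiv.symm (ContinuousLinearEquiv.funUnique (Fin 1) ℝ (EuclideanSpace ℝ (Fin 4))))) f)
    -- `|f̃|² νs = wgt μ_f`
    have hrel : ∀ n, (ν n).withDensity (fun p => ENNReal.ofReal (‖∫ a : (EuclideanSpace ℝ (Fin 4)), ((SchwartzMap.compCLMOfContinuousLinearEquiv ℂ (ContinuousLinearEquiv.symm (ContinuousLinearEquiv.funUnique (Fin 1) ℝ (EuclideanSpace ℝ (Fin 4))))) f) a *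
        cexp (-((a 0 * p 0 : ℝ) : ℂ) + ((∑ j : Fin 3, a j.succ * p j.succ : ℝ) : ℂ) * I)‖ ^ 2)) =
        μf.withDensity (fun p => ENNReal.ofReal (‖∫ a, u n a * cexp (-((a 0 * p 0 : ℝ) : ℂ) +
          ((∑ j : Fin 3, a j.succ * p j.succ : ℝ) : ℂ) * I)‖ ^ 2)) := fun n =>
      withDensity_transform_eq h f hf (u n) (inv_pos.2 (hRpos n)) (hsupp n) (hu_to n)
    have hkey : νs.withDensity (fun p => ENNReal.ofReal (‖∫ a : (EuclideanSpace ℝ (Fin 4)), ((SchwartzMap.compCLMOfContinuousLinearEquiv ℂ (ContinuousLinearEquiv.symm (ContinuousLinearEquiv.funUnique (Fin 1) ℝ (EuclideanSpace ℝ (Fin 4))))) f) a *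
        cexp (-((a 0 * p 0 : ℝ) : ℂ) + ((∑ j : Fin 3, a j.succ * p j.succ : ℝ) : ℂ) * I)‖ ^ 2)) =
        μf.withDensity wgt := by
      rw [hνs, withDensity_sum]
      simp_rw [withDensity_smul_measure, hrel]
      rw [hwgt, withDensity_tsum hg_meas]
      congr 1
      funext n
      rw [← withDensity_smul _ (((measurable_transform (u n)).norm.pow_const 2).ennreal_ofReal)]
      congr 1
      funext p
      simp only [hg, Pi.smul_apply, smul_eq_mul]
      rw [ENNReal.ofReal_mul (hc0 n)]
    have hμf_ae : ∀ᵐ p ∂μf, 0 ≤ p 0 := LaplaceFourierHalfSpace.ae_nonneg_apply_zero μf hμfJ.energy_nonneg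
    have hfinal : μ₀.withDensity (fun p => ENNReal.ofReal (‖∫ a : (EuclideanSpace ℝ (Fin 4)), ((SchwartzMap.compCLMOfContinuousLinearEquiv ℂ (ContinuousLinearEquiv.symm (ContinuousLinearEquiv.funUnique (Fin 1) ℝ (EuclideanSpace ℝ (Fin 4))))) f) a *
        cexp (-((a 0 * p 0 : ℝ) : ℂ) + ((∑ j : Fin 3, a j.succ * p j.succ : ℝ) : ℂ) * I)‖ ^ 2)) = μf := by
      rw [hμ₀, ← withDensity_mul _ hwinv_meas hρmeas]
      rw [show ((fun p => (wgt p)⁻¹) * fun p => ENNReal.ofReal (‖∫ a : (EuclideanSpace ℝ (Fin 4)), ((SchwartzMap.compCLMOfContinuousLinearEquiv ℂ (ContinuousLinearEquiv.symm (ContinuousLinearEquiv.funUnique (Fin 1) ℝ (EuclideanSpace ℝ (Fin 4))))) f) a *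
          cexp (-((a 0 * p 0 : ℝ) : ℂ) + ((∑ j : Fin 3, a j.succ * p j.succ : ℝ) : ℂ) * I)‖ ^ 2)) =
          (fun p => ENNReal.ofReal (‖∫ a : (EuclideanSpace ℝ (Fin 4)), ((SchwartzMap.compCLMOfContinuousLinearEquiv ℂ (ContinuousLinearEquiv.symm (ContinuousLinearEquiv.funUnique (Fin 1) ℝ (EuclideanSpace ℝ (Fin 4))))) f) a *
            cexp (-((a 0 * p 0 : ℝ) : ℂ) + ((∑ j : Fin 3, a j.succ * p j.succ : ℝ) : ℂ) * I)‖ ^ 2)) *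
            fun p => (wgt p)⁻¹ from mul_comm _ _]
      rw [withDensity_mul _ hρmeas hwinv_meas, hkey]
      exact withDensity_inv_same hwgt_meas
        (by filter_upwards [hμf_ae] with p hp using hwgt_ne_zero p hp)
        (by filter_upwards [hμf_ae] with p hp using hwgt_top p hp)
    rw [hfinal]
    exact hμfJ

end Summit.QuantumFields.YangMills.Theorems.NPointIsotropy.ComplexRotationBandlimit

end
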